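import Mathlib
import Summits.ResolutionOfSingularities.ResolutionOfSingularities.Theorems.RadicialJungCleanModelsPthPowerDescent
import Literature.AlgebraicGeometry.Resolution.RegularHomReduced
import HarnessLib

/-!
# Route `RadicialJung`, crux `CleanModels` (stmt-ResolutionOfSingularities-15917), line `Sketch` rev 35, stub 6 `stub_cleanProp44` (X44c),
# `τ = 1` residual, (B5″) algebraization step: `p`-TH POWERS DESCEND FROM THE COMPLETION OF A LOCAL G-RING

Seat decomp-res-hand-2 g13 (structural hand).  The instance of ✓ `…PthPowerDescent.lean` (`exists_pow_eq_of_pow_eq_algebraMap_of_faithfullyFlat`: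
`p`-th powers descend along reduced faithfully flat algebras with geometrically reduced generic fibre) that the (B5″) algebraization step of
hand-2 g12's memo §4 (c) consumes: for a local domain `A` of characteristic `p` which is a G-ring (✓ `Literature.AlgebraicGeometry.Resolution.IsGRing`
— e.g. `𝒪_{X,c} / 𝔮` on an excellent scheme), an element of `A` that is a `p`-th power in the `𝔪`-adic completion `Â` is a `p`-th power in `A`.
Ingredients, all landed or Mathlib: `Â` faithfully flat (`Module.FaithfullyFlat.of_flat_of_isLocalHom`), `Â` reduced (✓ `IsGRing.isReduced_adicCompletion`),
the generic formal fibre geometrically regular (✓ `IsGRing.isRegularHom_adicCompletion` at the prime `⊥`, tested against the finite field extension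
`K[T]/(T^p − x)` of `K = Frac A` when `x ∉ K^p`; regular rings are reduced, ✓ `IsRegularRing.isReduced'`).

* `exists_pow_eq_of_pow_eq_adicCompletion` — the statement above.
* `forall_pow_ne_adicCompletion` — contrapositive in the crux's currency: «`x` is not a `p`-th power in `A`» survives in `Â`.

Honest framing: OURS, folklore commutative algebra (cf. Matsumura, *Commutative Ring Theory*, §32); nothing here proves (B5″), the hypotheses of
✓ `cleanProp44_of_tauOneResidual`, X44c, any case of `CleanModels`, or resolution of singularities in characteristic `p`.
-/

set_option linter.dupNamespace false -- mandated namespace of this single-conjunct summit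

open Polynomial TensorProduct

namespace Summit.ResolutionOfSingularities.ResolutionOfSingularities.Theorems.RadicialJung.CleanModels

/-! ## §4 The instance: completions of local G-rings -/

section GRing

open IsLocalRing Literature.AlgebraicGeometry.Resolution

universe u

/-- **`p`-th powers descend from the completion of a local domain which is a G-ring.**  `A` a local domain of prime characteristic `p` with
`IsGRing A` (✓ `Literature.AlgebraicGeometry.Resolution.IsGRing`: Noetherian, `A → Â` regular); if `x ∈ A` is a `p`-th power in the
`𝔪`-adic completion `Â`, then `x` is a `p`-th power in `A`.  Ingredients, all landed or Mathlib: `Â` faithfully flat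
(`Module.FaithfullyFlat.of_flat_of_isLocalHom`), reduced (✓ `IsGRing.isReduced_adicCompletion`), and the generic formal fibre geometrically
regular (✓ `IsGRing.isRegularHom_adicCompletion` at the prime `⊥`, tested against the finite field extension `K[T]/(T^p − x)` of
`K = Frac A` when `x ∉ K^p`; regular rings are reduced, ✓ `IsRegularRing.isReduced'`). [folklore] -/
theorem exists_pow_eq_of_pow_eq_adicCompletion {A : Type u} [CommRing A] [IsDomain A] [IsLocalRing A]
    (hA : IsGRing A) (p : ℕ) [hp : Fact p.Prime] [CharP A p] {x : A}
    {g' : AdicCompletion (maximalIdeal A) A} (hg' : g' ^ p = algebraMap A _ x) : ∃ g : A, g ^ p = x := by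
  haveI : IsNoetherianRing A := hA.1
  haveI : Module.FaithfullyFlat A (AdicCompletion (maximalIdeal A) A) := Module.FaithfullyFlat.of_flat_of_isLocalHom
  haveI : IsReduced (AdicCompletion (maximalIdeal A) A) := hA.isReduced_adicCompletion
  have hpA : (p : A) = 0 := CharP.cast_eq_zero A p
  haveI : CharP (AdicCompletion (maximalIdeal A) A) p := (CharP.charP_iff_prime_eq_zero hp.out).2 (by
    rw [← map_natCast (algebraMap A (AdicCompletion (maximalIdeal A) A)), hpA, map_zero])
  haveI : CharP (⊥ : Ideal A).ResidueField p := (CharP.charP_iff_prime_eq_zero hp.out).2 (by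
    rw [← map_natCast (algebraMap A (⊥ : Ideal A).ResidueField), hpA, map_zero])
  refine exists_pow_eq_of_pow_eq_algebraMap_of_faithfullyFlat (K := (⊥ : Ideal A).ResidueField) p ?_ hg'
  intro hK
  set y : (⊥ : Ideal A).ResidueField := algebraMap A _ x
  -- `K' = K[T]/(T^p − y)` is a finite field extension of `K = Frac A`
  haveI : Fact (Irreducible (X ^ p - C y : ((⊥ : Ideal A).ResidueField)[X])) :=
    ⟨(X_pow_sub_C_irreducible_iff_of_prime hp.out).2 fun b => hK b⟩
  haveI : Module.Finite (⊥ : Ideal A).ResidueField (AdjoinRoot (X ^ p - C y : ((⊥ : Ideal A).ResidueField)[X])) :=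
    (monic_X_pow_sub_C y hp.out.ne_zero).finite_adjoinRoot
  -- the generic formal fibre is geometrically regular
  have hRH := hA.isRegularHom_adicCompletion
  haveI : IsRegularRing (AdjoinRoot (X ^ p - C y : ((⊥ : Ideal A).ResidueField)[X]) ⊗[(⊥ : Ideal A).ResidueField]
      ((⊥ : Ideal A).ResidueField ⊗[A] AdicCompletion (maximalIdeal A) A)) :=
    hRH.2 (⊥ : Ideal A) (AdjoinRoot (X ^ p - C y : ((⊥ : Ideal A).ResidueField)[X])) inferInstance
  haveI : IsReduced (AdjoinRoot (X ^ p - C y : ((⊥ : Ideal A).ResidueField)[X]) ⊗[(⊥ : Ideal A).ResidueField]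
      ((⊥ : Ideal A).ResidueField ⊗[A] AdicCompletion (maximalIdeal A) A)) := by
    have h := IsRegularRing.isReduced' (AdjoinRoot (X ^ p - C y : ((⊥ : Ideal A).ResidueField)[X]) ⊗[(⊥ : Ideal A).ResidueField]
      ((⊥ : Ideal A).ResidueField ⊗[A] AdicCompletion (maximalIdeal A) A))
    convert h using 0
  exact isReduced_of_injective
    (Algebra.TensorProduct.comm (⊥ : Ideal A).ResidueField
      ((⊥ : Ideal A).ResidueField ⊗[A] AdicCompletion (maximalIdeal A) A)
      (AdjoinRoot (X ^ p - C y : ((⊥ : Ideal A).ResidueField)[X]))).toRingHom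
    (Algebra.TensorProduct.comm _ _ _).injective


/-- **«Not a `p`-th power» survives completion** (contrapositive, the crux's currency `∀ c, c ^ p ≠ g₀`): for a local domain `A` of characteristic
`p` which is a G-ring and `x ∈ A` not a `p`-th power in `A`, `x` is not a `p`-th power in `Â`. [folklore] -/
theorem forall_pow_ne_adicCompletion {A : Type u} [CommRing A] [IsDomain A] [IsLocalRing A]
    (hA : IsGRing A) (p : ℕ) [Fact p.Prime] [CharP A p] {x : A} (hx : ∀ g : A, g ^ p ≠ x)
    (g' : AdicCompletion (maximalIdeal A) A) : g' ^ p ≠ algebraMap A _ x := by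
  intro h
  obtain ⟨g, hg⟩ := exists_pow_eq_of_pow_eq_adicCompletion hA p h
  exact hx g hg

end GRing

end Summit.ResolutionOfSingularities.ResolutionOfSingularities.Theorems.RadicialJung.CleanModels
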